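import Literature.AlgebraicGeometry.Resolution.AlterationsFibresConnectedProofs
import Literature.AlgebraicGeometry.Resolution.SteinFinitePartEtalePoint
import HarnessLib

/-!
# De Jong 1996, 4.12: "`Y' → ℙ^{d-1}` is (finite) étale" — the named fact discharged

Topic: `Literature/AlgebraicGeometry/Resolution`. Discharge of the named fact
`DeJong1996SteinFactorizationEtale` (`AlterationsFibresConnected.lean`; de Jong 1996, 4.12,
p. 68: "Note that `X'` is normal also. […] Let `X' → Y' → ℙ^{d-1}` be the Stein factorization
of `f`. Note that `Y' → ℙ^{d-1}` is (finite) étale, in view of property (ii) b) of the lemma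
(cf. [18])"): `theorem DeJong1996SteinFactorizationEtale_holds`.

The étale half is the general theorem `etale_fromNormalization_of_dense_smoothLocus`
(`SteinFinitePartEtalePoint.lean`: `k` algebraically closed, `X'` integral and normal, `f`
proper surjective with the smooth locus dense in every closed fibre ⇒ `f.fromNormalization` is
étale), applied in the situation of 4.12: `X'` is normal as the blowing up of the normal `X` in
finitely many regular closed points (`IsBlowup.isIntegrallyClosed_stalk_of_finite`, "Note that
`X'` is normal also"), integral (`IsLemma411Fibration.isAlteration`), `f` is proper
(`IsLemma411Fibration.isProper`) and surjective ((ii) a)), and (ii) b) is the density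
hypothesis; the finite half follows (`DeJong1996SteinFactorizationEtale.of_etale`: `π` is
integral, and finite = integral + locally of finite type). The proof uses neither henselisation
nor the coherence of `f_* 𝒪_{X'}` nor `π₁(ℙ^{d-1}) = 0`: sections through smooth points exist
over étale neighbourhoods (EGA IV 17.16.3), normality enters through Stacks 03GE, and étaleness
descends along fppf covers and is checked through 03GV (all in Mathlib).

Hypothesis d) of 4.12 (a smooth fibre) is not needed for this sentence.

## Sources

* A. J. de Jong, *Smoothness, semi-stability and alterations*, Publ. Math. IHÉS 83 (1996),
  Lemma 4.11 and 4.12, pp. 67–68. [DeJong1996]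
* The Stacks Project, Tags 035H, 03GE, 03GV, 02VN. [StacksProject]
-/

noncomputable section

open CategoryTheory CategoryTheory.Limits AlgebraicGeometry TopologicalSpace

namespace Literature.AlgebraicGeometry.Resolution

universe u

open Literature.AlgebraicGeometry.Motives (projectiveSpace)

/-- **De Jong 1996, 4.12: the finite part `Y' → ℙ^{d-1}` of the Stein factorisation of
`f : X' → ℙ^{d-1}` is finite étale** — the named fact `DeJong1996SteinFactorizationEtale`
holds. [cite: DeJong1996, 4.12, p. 68] -/
theorem DeJong1996SteinFactorizationEtale_holds : DeJong1996SteinFactorizationEtale.{u} :=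
  DeJong1996SteinFactorizationEtale.of_etale fun k _ _ X fX Z d X' φ f _ _ hP hd hF _ => by
    haveI := hP.isIntegral
    haveI := hP.isProper
    haveI : IsLocallyNoetherian X := LocallyOfFiniteType.isLocallyNoetherian fX
    haveI := (hF.isAlteration hP hd).isIntegral
    haveI := hF.isProper hP hd
    haveI : IsProper (projectiveSpace d k).hom := Motives.isProper_projectiveSpace d k
    haveI : Surjective f := hF.surjective
    obtain ⟨S, hS, hSf, hSc, hSreg, -, hblow⟩ := hF.exists_isBlowup
    have hN : ∀ x' : X', IsIntegrallyClosed (X'.presheaf.stalk x') := fun x' =>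
      hblow.isIntegrallyClosed_stalk_of_finite
        (isOpen_regularLocus_of_locallyOfFiniteType_perfectField fX) hP.isIntegrallyClosed hS
        hSf hSc hSreg x'
    haveI := hF.locallyOfFinitePresentation
    exact etale_fromNormalization_of_dense_smoothLocus hN (projectiveSpace d k).hom f
      (fun y _ => hF.dense_preimage_smoothLocus y)

end Literature.AlgebraicGeometry.Resolution

end
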